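import Summits.QuantumFields.GaugeBoot.OneOverNComponentSums
import HarnessLib

/-!
# Product functionals on loop sequences and the Leibniz rule (gauge-boot, ADDENDUM 30 part P)

HONEST FRAMING (cell `pub-gaugeboot`, page 1 of every file): the venture produces certified bounds
on lattice expectations at stated coupling, gauge group, dimension and torus size; NOT a mass gap,
NOT a continuum limit, NOT a string tension; NOT Yang–Mills-summit-bearing (barriers
`FixedCouplingUltralocality`, `PerturbativeInvisibility`).  Elementary algebra for the lane's first-order factorization theorem
(sibling `OneOverNFirstOrderFactorization`); nothing about four-dimensional continuum Yang–Mills or a mass gap.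

## Content

For functions `a, b` on words, a MULTIPLICATIVE functional `P` (`P(∅) = 1`, `P(l·u) = a(l)P(u)`, i.e. `P(l₁,…,lₙ) = Π a(lᵢ)`) and
its DERIVATION `Q` (`Q(∅) = 0`, `Q(l·u) = b(l)P(u) + a(l)Q(u)`, i.e. `Q(l₁,…,lₙ) = Σᵢ b(lᵢ)Π_{j≠i} a(lⱼ)`): the product and Leibniz
rules under concatenation (`mulFun_append`, `derFun_append`, three-block forms), the values on sequences of length `≤ 2`, on
pruned one-word lists, and the bounds `|P| ≤ 1`, `|Q(u)| ≤ #u · B · M^{|u|}` when `|a| ≤ 1`, `|b(l)| ≤ B M^{|l|}`.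

Everything is `[folklore]`.
-/

noncomputable section

open Finset
open Literature.MathematicalPhysics.QuantumFieldTheory.Chatterjee2019LargeN

namespace Summit.QuantumFields.GaugeBoot

namespace StringDuality

variable {d : ℕ}

section Leibniz

variable {a b : List (DEdge d) → ℝ} {P Q : LoopSeq d → ℝ}

/-- Product rule: `P(u ++ v) = P(u) P(v)`. [folklore] -/
theorem mulFun_append (hP0 : P [] = 1) (hPc : ∀ (l : List (DEdge d)) (u : LoopSeq d), P (l :: u) = a l * P u)
    (u v : LoopSeq d) : P (u ++ v) = P u * P v := by
  induction u with
  | nil => rw [List.nil_append, hP0, one_mul]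
  | cons l u ih => rw [List.cons_append, hPc, hPc, ih, mul_assoc]

/-- Leibniz rule: `Q(u ++ v) = Q(u) P(v) + P(u) Q(v)`. [folklore] -/
theorem derFun_append (hP0 : P [] = 1) (hPc : ∀ (l : List (DEdge d)) (u : LoopSeq d), P (l :: u) = a l * P u)
    (hQ0 : Q [] = 0) (hQc : ∀ (l : List (DEdge d)) (u : LoopSeq d), Q (l :: u) = b l * P u + a l * Q u)
    (u v : LoopSeq d) : Q (u ++ v) = Q u * P v + P u * Q v := by
  induction u with
  | nil => rw [List.nil_append, hQ0, hP0, zero_mul, one_mul, zero_add]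
  | cons l u ih => rw [List.cons_append, hQc, hQc, hPc, ih, mulFun_append hP0 hPc]; ring

/-- Three blocks, product. [folklore] -/
theorem mulFun_append3 (hP0 : P [] = 1) (hPc : ∀ (l : List (DEdge d)) (u : LoopSeq d), P (l :: u) = a l * P u)
    (u m v : LoopSeq d) : P (u ++ m ++ v) = P u * P m * P v := by
  rw [mulFun_append hP0 hPc, mulFun_append hP0 hPc]

/-- Three blocks, Leibniz. [folklore] -/
theorem derFun_append3 (hP0 : P [] = 1) (hPc : ∀ (l : List (DEdge d)) (u : LoopSeq d), P (l :: u) = a l * P u)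
    (hQ0 : Q [] = 0) (hQc : ∀ (l : List (DEdge d)) (u : LoopSeq d), Q (l :: u) = b l * P u + a l * Q u)
    (u m v : LoopSeq d) :
    Q (u ++ m ++ v) = Q u * P m * P v + P u * Q m * P v + P u * P m * Q v := by
  rw [derFun_append hP0 hPc hQ0 hQc, derFun_append hP0 hPc hQ0 hQc, mulFun_append hP0 hPc]; ring

/-- `P(l) = a(l)`. [folklore] -/
theorem mulFun_singleton (hP0 : P [] = 1) (hPc : ∀ (l : List (DEdge d)) (u : LoopSeq d), P (l :: u) = a l * P u)
    (l : List (DEdge d)) : P [l] = a l := by rw [hPc, hP0, mul_one]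

/-- `Q(l) = b(l)`. [folklore] -/
theorem derFun_singleton (hP0 : P [] = 1) (hQ0 : Q [] = 0)
    (hQc : ∀ (l : List (DEdge d)) (u : LoopSeq d), Q (l :: u) = b l * P u + a l * Q u)
    (l : List (DEdge d)) : Q [l] = b l := by rw [hQc, hP0, hQ0]; ring

/-- `P(x, y) = a(x) a(y)`. [folklore] -/
theorem mulFun_pair (hP0 : P [] = 1) (hPc : ∀ (l : List (DEdge d)) (u : LoopSeq d), P (l :: u) = a l * P u)
    (x y : List (DEdge d)) : P [x, y] = a x * a y := by rw [hPc, mulFun_singleton hP0 hPc]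

/-- `Q(x, y) = b(x) a(y) + a(x) b(y)`. [folklore] -/
theorem derFun_pair (hP0 : P [] = 1) (hPc : ∀ (l : List (DEdge d)) (u : LoopSeq d), P (l :: u) = a l * P u)
    (hQ0 : Q [] = 0) (hQc : ∀ (l : List (DEdge d)) (u : LoopSeq d), Q (l :: u) = b l * P u + a l * Q u)
    (x y : List (DEdge d)) : Q [x, y] = b x * a y + a x * b y := by
  rw [hQc, mulFun_singleton hP0 hPc, derFun_singleton hP0 hQ0 hQc]

/-- On a pruned one-word list: `P(prune(w)) = a(w)` if `w ≠ ∅`, `= 1` if `w = ∅`; uniformly `= A(prune(w))` for any `A` with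
`A(∅) = 1`, `A((w)) = a(w)`. [folklore] -/
theorem mulFun_prune_singleton (hP0 : P [] = 1) (hPc : ∀ (l : List (DEdge d)) (u : LoopSeq d), P (l :: u) = a l * P u)
    {A : LoopSeq d → ℝ} (hA0 : A [] = 1) (hA1 : ∀ w : List (DEdge d), w ≠ [] → A [w] = a w) (w : List (DEdge d)) :
    P (LoopSeq.prune [w]) = A (LoopSeq.prune [w]) := by
  rw [prune_singleton]
  split_ifs with h
  · rw [hP0, hA0]
  · rw [mulFun_singleton hP0 hPc, hA1 w h]

/-- On a pruned one-word list: `Q(prune(w)) = B(prune(w))` for any `B` with `B(∅) = 0`, `B((w)) = b(w)`. [folklore] -/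
theorem derFun_prune_singleton (hP0 : P [] = 1) (hQ0 : Q [] = 0)
    (hQc : ∀ (l : List (DEdge d)) (u : LoopSeq d), Q (l :: u) = b l * P u + a l * Q u)
    {B : LoopSeq d → ℝ} (hB0 : B [] = 0) (hB1 : ∀ w : List (DEdge d), w ≠ [] → B [w] = b w) (w : List (DEdge d)) :
    Q (LoopSeq.prune [w]) = B (LoopSeq.prune [w]) := by
  rw [prune_singleton]
  split_ifs with h
  · rw [hQ0, hB0]
  · rw [derFun_singleton hP0 hQ0 hQc, hB1 w h]

/-- `|P(u)| ≤ 1` when `|a| ≤ 1` on the components. [folklore] -/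
theorem abs_mulFun_le_one (hP0 : P [] = 1) (hPc : ∀ (l : List (DEdge d)) (u : LoopSeq d), P (l :: u) = a l * P u)
    {u : LoopSeq d} (ha : ∀ l ∈ u, |a l| ≤ 1) : |P u| ≤ 1 := by
  induction u with
  | nil => rw [hP0, abs_one]
  | cons l u ih =>
    rw [hPc, abs_mul]
    have h1 := ha l (by simp)
    have h2 := ih fun l' hl' => ha l' (by simp [hl'])
    calc |a l| * |P u| ≤ 1 * 1 := mul_le_mul h1 h2 (abs_nonneg _) zero_le_one
      _ = 1 := one_mul 1

/-- `|Q(u)| ≤ #u · B · M^{|u|}` when `|a| ≤ 1` and `|b(l)| ≤ B M^{|l|}` on the components (`B ≥ 0`, `M ≥ 1`). [folklore] -/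
theorem abs_derFun_le (hP0 : P [] = 1) (hPc : ∀ (l : List (DEdge d)) (u : LoopSeq d), P (l :: u) = a l * P u)
    (hQ0 : Q [] = 0) (hQc : ∀ (l : List (DEdge d)) (u : LoopSeq d), Q (l :: u) = b l * P u + a l * Q u)
    {B M : ℝ} (hB : 0 ≤ B) (hM : 1 ≤ M) {u : LoopSeq d} (ha : ∀ l ∈ u, |a l| ≤ 1)
    (hb : ∀ l ∈ u, |b l| ≤ B * M ^ l.length) : |Q u| ≤ u.length * (B * M ^ LoopSeq.len u) := by
  induction u with
  | nil => rw [hQ0, abs_zero]; positivity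
  | cons l u ih =>
    have ha' : ∀ l' ∈ u, |a l'| ≤ 1 := fun l' hl' => ha l' (by simp [hl'])
    have hb' : ∀ l' ∈ u, |b l'| ≤ B * M ^ l'.length := fun l' hl' => hb l' (by simp [hl'])
    have h1 := ha l (by simp)
    have h2 := hb l (by simp)
    have hPu := abs_mulFun_le_one hP0 hPc ha'
    have hQu := ih ha' hb'
    rw [hQc, List.length_cons, LoopSeq.len_cons, Nat.cast_succ, pow_add]
    have hMl : (1 : ℝ) ≤ M ^ l.length := one_le_pow₀ hM
    have hMu : (1 : ℝ) ≤ M ^ LoopSeq.len u := one_le_pow₀ hM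
    calc |b l * P u + a l * Q u| ≤ |b l| * |P u| + |a l| * |Q u| := by
          refine (abs_add_le _ _).trans ?_; rw [abs_mul, abs_mul]
      _ ≤ B * M ^ l.length * 1 + 1 * (u.length * (B * M ^ LoopSeq.len u)) :=
          add_le_add (mul_le_mul h2 hPu (abs_nonneg _) (by positivity))
            (mul_le_mul h1 hQu (abs_nonneg _) zero_le_one)
      _ ≤ (u.length + 1) * (B * (M ^ l.length * M ^ LoopSeq.len u)) := by
          have e1 : B * M ^ l.length * 1 ≤ B * (M ^ l.length * M ^ LoopSeq.len u) := by
            rw [mul_one]; exact mul_le_mul_of_nonneg_left (le_mul_of_one_le_right (by positivity) hMu) hB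
          have e2 : (u.length : ℝ) * (B * M ^ LoopSeq.len u) ≤ u.length * (B * (M ^ l.length * M ^ LoopSeq.len u)) :=
            mul_le_mul_of_nonneg_left (mul_le_mul_of_nonneg_left (le_mul_of_one_le_left (by positivity) hMl) hB)
              (Nat.cast_nonneg _)
          linarith

end Leibniz

end StringDuality

end Summit.QuantumFields.GaugeBoot

end
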